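import Summits.Ventures.LatticeQCDFlow.Scaling.UnitSurvivalFloor

/-!
HONEST FRAMING: exact (Metropolis-corrected) sampling algorithms for lattice gauge theory; figures
of merit are autocorrelation/cost numbers at stated couplings and volumes; no continuum-physics
claim.

# IdealStarFourTermLaw — THE IDEALISED HOT-ONLY STAR FROM FOUR SIDES AT UNIFORM LISTING (`m = cK`, `K ≥ 4`,
# `|S| ≥ 4(K+1)`): `(K − 1)·log(K/4) ≤ t_mix(1/4)`, `(K+1)/(2(1−t)) ≤ t_mix(1/4)`, `(K/(t(1−t)) − 1)·log 2 ≤ t_mix(1/4)`,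
# `t_mix(1/4) ≤ ⌈((K+t)/(t(1−t)))·log((K + b*)/(b*/4))⌉` — THE NEW THIRD TERM CARRIES THE CEILING'S UNIT `K/(t(1−t))`
# (lean-2 GEN-27, ours)

Venture-side (OURS).  Cell `lqcd-flow` (pub-lqcd), unit `pub-lqcd-lean-2-g27`, 2026-08-27.  Chapter M, the floor side,
file 4 — `Scaling/IdealStarThreeTermLaw` with the unit-survival floor of `Scaling/UnitSurvivalFloor` added.  Setting
of `Scaling/IdealStarThreeTermLaw` (one positive unit-mass law `ν` at every level, hub list `κ` listing every cold
level at least `c ≥ 1` times with `m = cK` — hence exactly `c` times, `hubMult_eq_of_uniform` — identity maps,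
hot-only updates with the exact hot sampler, `ν`-reversible kernels, `0 < t < 1`).

## What is proved

* `hubMult_le_of_uniform` — `m = cK` and every multiplicity `≥ c` force every multiplicity `≤ c`.
* **`idealStar_fourTerm_law`** — the conjunction of the collector floor `(K−1)·log(K/4)`, the refresh floor
  `(K+1)/(2(1−t))`, the unit-survival floor `(K/(t(1−t)) − 1)·log 2` and the retuned ceiling
  `⌈((K+t)/(t(1−t)))·log((K + b*)/(b*·(1/4)))⌉`, `b* = t(K+1)/(K+t)`, for `t_mix(1/4)`.

Reading (no numerics implied): the third floor is the first to grow like the ceiling in BOTH limits `t → 0` and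
`t → 1`; only the logarithm of the ceiling is not matched (OPEN-MATH item 2: a second-moment argument over `K`
planted units).  NOT CLAIMED: the `log K` on the third floor; anything measured.  Literature grade (cell rule): OWN
COMPOSITION; nothing cited as a fact; no new bib keys.
-/

noncomputable section

open Finset Function
open Literature.Probability.MarkovChains

namespace Summit.Ventures.LatticeQCDFlow.Scaling

variable {S : Type*} [Fintype S] [DecidableEq S] {K m : ℕ} {ν : S → ℝ} {M : Fin (K + 1) → S → S → ℝ} {t : ℝ}

section FourTerm
variable (κ : Fin m → Fin K)

omit [Fintype S] [DecidableEq S] in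
/-- **Uniform listing:** if every cold level is listed at least `c` times and `m = cK`, then every cold level is
listed at most (hence exactly) `c` times. [ours] -/
theorem hubMult_le_of_uniform {c : ℕ} (hc : ∀ p' : Fin K, c ≤ (univ.filter (fun r : Fin m => κ r = p')).card)
    (hmc : m = c * K) (p' : Fin K) : (univ.filter (fun r : Fin m => κ r = p')).card ≤ c := by
  by_contra hlt
  push Not at hlt
  have hsum := hubList_sum_degree (K := K) κ
  have hgt : (c : ℝ) * K < ∑ k : Fin K, ((univ.filter (fun r : Fin m => κ r = k)).card : ℝ) := by
    calc (c : ℝ) * K = ∑ _k : Fin K, (c : ℝ) := by rw [sum_const, card_univ, Fintype.card_fin, nsmul_eq_mul]; ring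
      _ < ∑ k : Fin K, ((univ.filter (fun r : Fin m => κ r = k)).card : ℝ) := by
          refine Finset.sum_lt_sum (fun k _ => by exact_mod_cast hc k) ⟨p', mem_univ _, by exact_mod_cast hlt⟩
  rw [hsum, hmc, Nat.cast_mul] at hgt
  exact lt_irrefl _ hgt

/-- **THE IDEALISED HOT-ONLY STAR FROM FOUR SIDES:** `K ≥ 4`, `|S| ≥ 4(K+1)`, `m = cK` with every cold level listed
`≥ c ≥ 1` times, `0 < t < 1`, `ν > 0` of unit mass, `ν`-reversible row-stochastic kernels, exact hot sampler:
**`(K − 1)·log(K/4) ≤ t_mix(1/4)`, `(K+1)/(2(1−t)) ≤ t_mix(1/4)`, `(K/(t(1−t)) − 1)·log 2 ≤ t_mix(1/4)`, and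
`t_mix(1/4) ≤ ⌈((K+t)/(t(1−t)))·log((K + b*)/(b*·(1/4)))⌉`** with `b* = t(K+1)/(K+t)`. [ours] -/
theorem idealStar_fourTerm_law (hK : 4 ≤ K) (hS : 4 * (K + 1) ≤ Fintype.card S) (ht0 : 0 < t) (ht1 : t < 1)
    (hν : ∀ v, 0 < ν v) (hν1 : ∑ v, ν v = 1) (hM : ∀ k, IsRowStochastic (M k)) (hMrev : ∀ k, DetailedBalance ν (M k))
    (hM0 : ∀ u v, M 0 u v = ν v) {c : ℕ} (hc1 : 1 ≤ c)
    (hc : ∀ p' : Fin K, c ≤ (univ.filter (fun r : Fin m => κ r = p')).card) (hmc : m = c * K) :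
    ((K : ℝ) - 1) * Real.log (K / 4)
        ≤ (mixingTime (fun y z : Fin (K + 1) → S => t * ptGraphSwap (fun _ : Fin (K + 1) => ν)
            (fun r : Fin m => (((0 : Fin (K + 1)), (κ r).succ) : Fin (K + 1) × Fin (K + 1))) (fun _ => Equiv.refl S) y z
            + (1 - t) * prodKernel (fun k : Fin (K + 1) => if k = 0 then (1 : ℝ) else 0) M y z)
          (tensorFun (fun _ : Fin (K + 1) => ν)) (1 / 4) : ℝ) ∧
      ((K : ℝ) + 1) / (2 * (1 - t))
        ≤ (mixingTime (fun y z : Fin (K + 1) → S => t * ptGraphSwap (fun _ : Fin (K + 1) => ν)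
            (fun r : Fin m => (((0 : Fin (K + 1)), (κ r).succ) : Fin (K + 1) × Fin (K + 1))) (fun _ => Equiv.refl S) y z
            + (1 - t) * prodKernel (fun k : Fin (K + 1) => if k = 0 then (1 : ℝ) else 0) M y z)
          (tensorFun (fun _ : Fin (K + 1) => ν)) (1 / 4) : ℝ) ∧
      ((K : ℝ) / (t * (1 - t)) - 1) * Real.log 2
        ≤ (mixingTime (fun y z : Fin (K + 1) → S => t * ptGraphSwap (fun _ : Fin (K + 1) => ν)
            (fun r : Fin m => (((0 : Fin (K + 1)), (κ r).succ) : Fin (K + 1) × Fin (K + 1))) (fun _ => Equiv.refl S) y z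
            + (1 - t) * prodKernel (fun k : Fin (K + 1) => if k = 0 then (1 : ℝ) else 0) M y z)
          (tensorFun (fun _ : Fin (K + 1) => ν)) (1 / 4) : ℝ) ∧
      mixingTime (fun y z : Fin (K + 1) → S => t * ptGraphSwap (fun _ : Fin (K + 1) => ν)
            (fun r : Fin m => (((0 : Fin (K + 1)), (κ r).succ) : Fin (K + 1) × Fin (K + 1))) (fun _ => Equiv.refl S) y z
            + (1 - t) * prodKernel (fun k : Fin (K + 1) => if k = 0 then (1 : ℝ) else 0) M y z)
          (tensorFun (fun _ : Fin (K + 1) => ν)) (1 / 4)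
        ≤ ⌈((K : ℝ) + t) / (t * (1 - t))
            * Real.log (((K : ℝ) + t * ((K : ℝ) + 1) / (t * ((K : ℝ) + 1) + (1 - t) * K))
              / (t * ((K : ℝ) + 1) / (t * ((K : ℝ) + 1) + (1 - t) * K) * (1 / 4)))⌉₊ := by
  obtain ⟨h1, h2, h4⟩ := idealStar_threeTerm_law κ hK hS ht0 ht1 hν hν1 hM hMrev hM0 hc1 hc hmc
  refine ⟨h1, h2, ?_, h4⟩
  have hm : 1 ≤ m := by rw [hmc]; exact Nat.one_le_iff_ne_zero.mpr (Nat.mul_ne_zero (by omega) (by omega))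
  have hcm : c ≤ m := by rw [hmc]; exact Nat.le_mul_of_pos_right c (by omega)
  have hμ : ∀ (k : Fin (K + 1)) (v : S), 0 < (fun _ : Fin (K + 1) => ν) k v := fun _ v => hν v
  have hμ1 : ∀ k : Fin (K + 1), ∑ u, (fun _ : Fin (K + 1) => ν) k u = 1 := fun _ => hν1
  have hM0' : ∀ u v, M 0 u v = (fun _ : Fin (K + 1) => ν) 0 v := hM0
  have hperf : ∀ (r : Fin m) (u : S), (fun _ : Fin (K + 1) => ν) (κ r).succ ((fun _ : Fin m => Equiv.refl S) r u)
      = (fun _ : Fin (K + 1) => ν) 0 u := fun _ _ => rfl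
  have hw0 : ∀ k : Fin (K + 1), 0 ≤ (if k = 0 then (1 : ℝ) else 0) := fun k => by split_ifs <;> norm_num
  have hw00 : (0 : ℝ) < (if (0 : Fin (K + 1)) = 0 then (1 : ℝ) else 0) := by rw [if_pos rfl]; norm_num
  have hw1 : ∑ k : Fin (K + 1), (if k = 0 then (1 : ℝ) else 0) = 1 := by
    rw [Finset.sum_ite_eq' univ (0 : Fin (K + 1)), if_pos (mem_univ _)]
  have hstat : ∀ k : Fin (K + 1), k ≠ 0 → ∀ v, ∑ u, (fun _ : Fin (K + 1) => ν) k u * M k u v = (fun _ : Fin (K + 1) => ν) k v :=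
    fun k _ v => (hMrev k).isStationary (hM k).2 v
  have hmix : ∃ t₀, worstTvDist (fun y z : Fin (K + 1) → S => t * ptGraphSwap (fun _ : Fin (K + 1) => ν)
      (fun r : Fin m => (((0 : Fin (K + 1)), (κ r).succ) : Fin (K + 1) × Fin (K + 1))) (fun _ => Equiv.refl S) y z
      + (1 - t) * prodKernel (fun k : Fin (K + 1) => if k = 0 then (1 : ℝ) else 0) M y z)
      (tensorFun (fun _ : Fin (K + 1) => ν)) t₀ ≤ 1 / 4 :=
    ⟨_, perfectStar_worstTvDist_le_of_ge_log κ (fun _ => Equiv.refl S) (μ := fun _ : Fin (K + 1) => ν) hm ht0 ht1 hw0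
      hw00 hw1 hμ hμ1 hM hM0' hstat hperf hc1 hc hcm (by norm_num : (0:ℝ) < 1 / 4) (Nat.le_ceil _)⟩
  exact uniformStar_unitSurvival_floor κ (by omega) hS ht0 ht1 hν hν1 hM hMrev hc1 (hubMult_le_of_uniform κ hc hmc) hmc hmix

end FourTerm

end Summit.Ventures.LatticeQCDFlow.Scaling

end
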